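import Summits.ResolutionOfSingularities.ResolutionOfSingularities.Theorems.WildConesCampaignW46HypersurfacesCharTwoEmbDimDefs
import Summits.ResolutionOfSingularities.ResolutionOfSingularities.Theorems.WildConesCampaignW46ThreefoldsCharTwoSplittingRegime
import Literature.AlgebraicGeometry.Resolution.JetsUnramified

/-!
# [OURS · L1 W4.6, rung (ii) at p = 2, EVERY dimension n] The embedding dimension of the Milnor algebra
# of a hypersurface double point in characteristic two: invariance, the residual descent, range and
# PARITY, and the hyperbolic-pair criterion — over every field of characteristic 2

HONEST FRAMING. Everything here is OURS: theorems about route WildCones' own TYPED point-blow-up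
dynamics (`Theorems/WildConesClassicalRegimesDefs.lean`: a state is the coefficient function `c` of
`a = Σ c(A) u^A`, the atom is `z² = a(u₁,…,uₙ)`; `step` = blow up the closed point, chart `u_i`, divide by
`u_i²`, translate by `τ`, delete square monomials; `MultP` = cleaned order `≥ 2` (a double point), `OrdP`
= a cleaned monomial of degree `2` (a hyperbolic pair `u_j u_l`), `Isol` = finite Milnor algebra
`κ⟦u⟧/(∂a)`, `mu` = its dimension) and the two numbers of
`Theorems/WildConesCampaignW46HypersurfacesCharTwoEmbDimDefs.lean` (p498937): `jetTwoColength f =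
dim_κ κ⟦X⟧/((∂f) + 𝔪²)` and `milnorEmbDim p n κ c = jetTwoColength (ser c) - 1 =` the EMBEDDING DIMENSION
`e(c)` of the Milnor algebra (for a double point in characteristic `2`: the corank of the polar form of
the cleaned quadratic part). NOTHING here is a statement of the manuscript [Hironaka2017] and nothing of
it is used; no FACT-LIST premise is used (the hyperbolic-pair splitting of Greuel–Pfister is a kernel
theorem of the tree, `WildCones.MuDropCharTwoOrdP.pair_reduction` / `descent` / `descent_step`). AI
review is weaker than expert review. Cell res-hironaka (LADDER-RESOLUTION rung L, D-0089), slot W4.6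
«restricted regimes as rungs», seat res-L1-s46-pv-4 (gen 3): «(ii) THREEFOLD HYPERSURFACES, second
prover: the p = 2 hyperbolic-splitting regime of `ClassicalRegimes` (n ≥ 3, order-2 cleaned states)».
Host: route `WildCones`, crux `ClassicalRegimes` (stmt-ResolutionOfSingularities-16884; proved).
First of three files (`…EmbDim`, `…EmbDimStates`, `…EmbDimDynamics`).

WHY. The seat's gen-2 files (p479260 … p485613) settle threefolds (`n = 3`): the order-2-cleaned regime
`MultP ∧ OrdP ∧ Isol` is closed under the dynamics with exact drop `μ' + 2 = μ`, isolated/non-isolated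
dichotomy, `μ` even, Milnor algebra `κ⟦X⟧/(X^μ)`, resolution within `μ/2`. For `n ≥ 4` `OrdP` is the
wrong regime — closure FAILS (`n = 4`: p485483, `n = 5`: p484275). The right regime in every dimension
is cut out by the embedding dimension `e(c)` of the Milnor algebra: `e ≤ 1` («curvilinear Milnor
algebra»; polar form of corank `≤ 1`). This file builds the invariant; the two sequels prove the regime
theorems.

WHAT IS NEW (every `n`, every field of characteristic `2`; all statements about formal power series
`f ∈ κ⟦X₁,…,Xₙ⟧` of order `≥ 2`, instantiated to states in the sequels):

* `jetTwoColength_eq_of_equiv` — `dim_κ κ⟦X⟧/((∂f) + 𝔪²)` is an INVARIANT of the `κ`-algebra `κ⟦X⟧/(∂f)`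
  (even across different numbers of variables): it is `dim_κ A/𝔪_A²` (`finrank_quot_sup_sq_eq_of_quot_equiv`,
  pure commutative algebra: local `κ`-algebras `A ⧸ I ≃ₐ B ⧸ J` have equal `dim (A/(I+𝔪²))`).
* `jetTwoColength_of_pderiv_mem_sq`, `finrank_quot_maximalIdeal_sq` — the leaf value `n + 1` when all
  partials lie in `𝔪²` (`dim_κ κ⟦X₁,…,Xₙ⟧/𝔪² = n + 1` through the tree's regular-local-ring count);
  `pderiv_mem_maximalIdeal_sq` — in characteristic two this happens iff `f` has no square-free quadratic
  monomial (`[X_s] ∂ₛ f = 2 [X_s²] f = 0`).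
* `exists_residual` — THE RESIDUAL DESCENT: iterated Greuel–Pfister splitting of hyperbolic pairs
  (`pair_reduction` + `descent`, no blow-up involved) carries the Milnor algebra of `f` isomorphically to
  that of a residual `g` in `m ≤ n` variables, `m ≡ n (mod 2)`, without square-free quadratic monomial;
  hence `jetTwoColength f = m + 1` (`jetTwoColength_eq_of_residual`): THE EMBEDDING DIMENSION IS THE NUMBER
  OF RESIDUAL VARIABLES.
* `jetTwoColength_range` — RANGE AND PARITY: `0 ≤ e ≤ n`, `e ≡ n (mod 2)` (the polar form is alternating,
  its rank `n - e` is even); `exists_pair_iff_jetTwoColength` — a square-free quadratic monomial exists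
  iff `e ≤ n - 2`.

References: G.-M. Greuel, G. Pfister, The splitting lemma in any characteristic, J. Algebra 689 (2026)
= arXiv:2507.17078, Thm 3.5 / Cor 3.7 [GreuelPfister2026] (through the tree's `pair_reduction`,
`descent`, `descent_step`); H. Hironaka, ms. 2017-03-23 [Hironaka2017], Th. 16.6 p.84, Th. 16.13 p.87 —
quoted for the ROLE replaced only, under adjudication, not cited as fact.
-/

noncomputable section

-- single-problem summit: the doubled namespace component `ResolutionOfSingularities` is forced
set_option linter.dupNamespace false

open scoped BigOperators Classical

open MvPowerSeries IsLocalRing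

open Literature.AlgebraicGeometry.Resolution

namespace Summit.ResolutionOfSingularities.ResolutionOfSingularities.Theorems

namespace CampaignW46.HypersurfacesCharTwo

open WildCones WildCones.MuDropCharTwoOrdP ThreefoldsCharTwo

variable {κ : Type} [Field κ]

/-! ## The colength of `I + 𝔪²` is an invariant of the `κ`-algebra `A ⧸ I` -/

/-- For a surjective `κ`-algebra map `K : A → T` of local rings with kernel `I`,
`dim_κ A/(I + 𝔪_A²) = dim_κ T/𝔪_T²`. [folklore] -/
theorem finrank_quot_sup_sq_eq_of_surjective {A T : Type} [CommRing A] [CommRing T] [Algebra κ A]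
    [Algebra κ T] [IsLocalRing A] [IsLocalRing T] (K : A →ₐ[κ] T) (hK : Function.Surjective K)
    (I : Ideal A) (hI : RingHom.ker (K : A →+* T) = I) :
    Module.finrank κ (A ⧸ (I ⊔ maximalIdeal A ^ 2)) =
      Module.finrank κ (T ⧸ maximalIdeal T ^ 2) := by
  obtain ⟨ε⟩ := exists_quot_equiv_of_surjective K hK (I ⊔ maximalIdeal A ^ 2)
    (hI.le.trans le_sup_left)
  have hmap : (I ⊔ maximalIdeal A ^ 2).map (K : A →+* T) = maximalIdeal T ^ 2 := by
    rw [Ideal.map_sup, Ideal.map_pow, IsLocalRing.map_maximalIdeal_of_surjective (K : A →+* T) hK,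
      (Ideal.map_eq_bot_iff_le_ker (K : A →+* T)).mpr hI.ge, bot_sup_eq]
  exact (ε.trans (Ideal.quotientEquivAlgOfEq κ hmap)).toLinearEquiv.finrank_eq

/-- **`dim_κ A/(I + 𝔪_A²)` depends only on the `κ`-algebra `A ⧸ I`** (local `κ`-algebras `A`, `B`,
ideals `I`, `J` with `A ⧸ I ≃ₐ[κ] B ⧸ J`). [folklore] -/
theorem finrank_quot_sup_sq_eq_of_quot_equiv {A B : Type} [CommRing A] [CommRing B] [Algebra κ A]
    [Algebra κ B] [IsLocalRing A] [IsLocalRing B] (I : Ideal A) (J : Ideal B)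
    (ε : (A ⧸ I) ≃ₐ[κ] (B ⧸ J)) :
    Module.finrank κ (A ⧸ (I ⊔ maximalIdeal A ^ 2)) =
      Module.finrank κ (B ⧸ (J ⊔ maximalIdeal B ^ 2)) := by
  by_cases hJ : J = ⊤
  · have hI : I = ⊤ := by
      rw [← Ideal.Quotient.subsingleton_iff] at hJ ⊢
      exact ε.toEquiv.subsingleton
    haveI := Ideal.Quotient.subsingleton_iff.mpr (show I ⊔ maximalIdeal A ^ 2 = ⊤ by
      rw [hI, top_sup_eq])
    haveI := Ideal.Quotient.subsingleton_iff.mpr (show J ⊔ maximalIdeal B ^ 2 = ⊤ by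
      rw [hJ, top_sup_eq])
    rw [Module.finrank_zero_of_subsingleton, Module.finrank_zero_of_subsingleton]
  · haveI : Nontrivial (B ⧸ J) := Ideal.Quotient.nontrivial_iff.mpr hJ
    haveI : IsLocalRing (B ⧸ J) :=
      IsLocalRing.of_surjective' (Ideal.Quotient.mk J) Ideal.Quotient.mk_surjective
    let K₁ : A →ₐ[κ] B ⧸ J := (ε : (A ⧸ I) →ₐ[κ] (B ⧸ J)).comp (Ideal.Quotient.mkₐ κ I)
    have hK₁ : Function.Surjective K₁ :=
      ε.surjective.comp (Ideal.Quotient.mkₐ_surjective κ I)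
    have hker₁ : RingHom.ker (K₁ : A →+* B ⧸ J) = I := by
      ext x
      rw [RingHom.mem_ker]
      change ε (Ideal.Quotient.mk I x) = 0 ↔ x ∈ I
      rw [map_eq_zero_iff ε ε.injective, Ideal.Quotient.eq_zero_iff_mem]
    have hker₂ : RingHom.ker (Ideal.Quotient.mkₐ κ J : B →+* B ⧸ J) = J := Ideal.Quotient.mkₐ_ker κ J
    rw [finrank_quot_sup_sq_eq_of_surjective K₁ hK₁ I hker₁,
      finrank_quot_sup_sq_eq_of_surjective (Ideal.Quotient.mkₐ κ J) (Ideal.Quotient.mkₐ_surjective κ J)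
        J hker₂]

/-- [OURS · L1 W4.6] **`jetTwoColength` is an invariant of the Milnor algebra**: series in possibly
different numbers of variables with `κ`-isomorphic Milnor algebras have the same colength of
`(∂f) + 𝔪²`. [folklore] -/
theorem jetTwoColength_eq_of_equiv {n m : ℕ} {f : MvPowerSeries (Fin n) κ}
    {g : MvPowerSeries (Fin m) κ}
    (ε : (MvPowerSeries (Fin n) κ ⧸ Ideal.span (Set.range fun s => MvPowerSeries.pderiv s f)) ≃ₐ[κ]
      (MvPowerSeries (Fin m) κ ⧸ Ideal.span (Set.range fun t => MvPowerSeries.pderiv t g))) :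
    jetTwoColength f = jetTwoColength g :=
  finrank_quot_sup_sq_eq_of_quot_equiv _ _ ε

/-! ## The leaf value: all partials in `𝔪²` -/

/-- `κ → κ⟦X₁,…,Xₙ⟧/𝔪` is bijective. [folklore] -/
theorem bijective_algebraMap_residueField (n : ℕ) :
    Function.Bijective (algebraMap κ (ResidueField (MvPowerSeries (Fin n) κ))) := by
  refine ⟨(algebraMap κ _).injective, fun x => ?_⟩
  obtain ⟨f, rfl⟩ := IsLocalRing.residue_surjective x
  refine ⟨constantCoeff f, ?_⟩
  rw [IsScalarTower.algebraMap_apply κ (MvPowerSeries (Fin n) κ) (ResidueField _)]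
  change IsLocalRing.residue _ (algebraMap κ (MvPowerSeries (Fin n) κ) (constantCoeff f)) =
    IsLocalRing.residue _ f
  refine (Ideal.Quotient.eq (I := maximalIdeal (MvPowerSeries (Fin n) κ))).mpr ?_
  rw [Literature.RingTheory.MvPowerSeries.Jets.mem_maximalIdeal_iff_constantCoeff_eq_zero,
    map_sub, MvPowerSeries.algebraMap_apply, Algebra.algebraMap_self, RingHom.id_apply,
    constantCoeff_C, sub_self]

/-- `dim_κ κ⟦X₁,…,Xₙ⟧/𝔪² = n + 1`. [folklore] -/
theorem finrank_quot_maximalIdeal_sq (n : ℕ) :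
    Module.finrank κ (MvPowerSeries (Fin n) κ ⧸ maximalIdeal (MvPowerSeries (Fin n) κ) ^ 2) =
      n + 1 := by
  haveI := (isRegularLocalRing_mvPowerSeries_fin κ n).1
  exact (BertiniAffine.finrank_quotient_maximalIdeal_sq_of_isRegularLocalRing
    (bijective_algebraMap_residueField n) (isRegularLocalRing_mvPowerSeries_fin κ n).2).2

/-- [OURS · L1 W4.6] **The leaf value**: if every partial of `f ∈ κ⟦X₁,…,Xₙ⟧` lies in `𝔪²` then
`jetTwoColength f = n + 1` (embedding dimension `n`). [folklore] -/
theorem jetTwoColength_of_pderiv_mem_sq {n : ℕ} {f : MvPowerSeries (Fin n) κ}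
    (h : ∀ s, MvPowerSeries.pderiv s f ∈ maximalIdeal (MvPowerSeries (Fin n) κ) ^ 2) :
    jetTwoColength f = n + 1 := by
  have hle : Ideal.span (Set.range fun s => MvPowerSeries.pderiv s f) ≤
      maximalIdeal (MvPowerSeries (Fin n) κ) ^ 2 := by
    rw [Ideal.span_le]
    rintro _ ⟨s, rfl⟩
    exact h s
  unfold jetTwoColength
  rw [(Ideal.quotientEquivAlgOfEq κ (sup_eq_right.mpr hle)).toLinearEquiv.finrank_eq]
  exact finrank_quot_maximalIdeal_sq n

/-! ## Characteristic two: no hyperbolic pair means all partials in `𝔪²` -/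

/-- An exponent of degree one is a `single`. [folklore] -/
theorem exists_eq_single_of_degree_eq_one {n : ℕ} {e : Fin n →₀ ℕ} (he : e.degree = 1) :
    ∃ t, e = Finsupp.single t 1 := by
  rw [Finsupp.degree_eq_sum] at he
  have hex : ∃ t, e t ≠ 0 := by
    by_contra h0
    push Not at h0
    rw [Finset.sum_eq_zero (fun j _ => h0 j)] at he
    exact zero_ne_one he
  obtain ⟨t, ht⟩ := hex
  have hle : ∀ s, e s ≤ 1 := fun s =>
    he ▸ Finset.single_le_sum (f := fun j => e j) (fun _ _ => Nat.zero_le _) (Finset.mem_univ s)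
  refine ⟨t, Finsupp.ext fun s => ?_⟩
  by_cases hs : s = t
  · subst hs
    have := hle s
    rw [Finsupp.single_eq_same]
    omega
  · have h2 : e t + e s ≤ Finset.sum Finset.univ (fun j => e j) :=
      Finset.add_le_sum (fun _ _ => Nat.zero_le _) (Finset.mem_univ t) (Finset.mem_univ s)
        (Ne.symm hs)
    rw [Finsupp.single_apply, if_neg (Ne.symm hs)]
    omega

/-- [OURS · L1 W4.6] **Characteristic two**: if `f ∈ κ⟦X₁,…,Xₙ⟧` has no linear terms and no
square-free quadratic monomial `X_j X_l` (`j ≠ l`) then every partial `∂ₛ f` lies in `𝔪²` — the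
linear part of `∂ₛ f` is the `s`-th row `(q_{st})_t` of the polar matrix, and `[X_s] ∂ₛ f = 2 [X_s²] f
= 0`. [folklore] -/
theorem pderiv_mem_maximalIdeal_sq [CharP κ 2] {n : ℕ} {f : MvPowerSeries (Fin n) κ}
    (h1 : ∀ s, coeff (Finsupp.single s 1) f = 0)
    (h2 : ∀ j l : Fin n, j ≠ l → coeff (Finsupp.single j 1 + Finsupp.single l 1) f = 0)
    (s : Fin n) :
    MvPowerSeries.pderiv s f ∈ maximalIdeal (MvPowerSeries (Fin n) κ) ^ 2 := by
  refine Literature.RingTheory.MvPowerSeries.Jets.mem_maximalIdeal_pow_of_coeff_eq_zero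
    fun e he => ?_
  rw [MvPowerSeries.coeff_pderiv]
  have hdeg : e.degree = 0 ∨ e.degree = 1 := by omega
  rcases hdeg with h0 | h1'
  · rw [Finsupp.degree_eq_zero_iff] at h0
    subst h0
    rw [zero_add, h1 s, mul_zero]
  · obtain ⟨t, rfl⟩ := exists_eq_single_of_degree_eq_one h1'
    by_cases hts : t = s
    · subst hts
      have h2' : ((Finsupp.single t 1 : Fin n →₀ ℕ) t : κ) + 1 = 0 := by
        rw [Finsupp.single_eq_same, Nat.cast_one]
        exact CharTwo.add_self_eq_zero (1 : κ)
      rw [h2', zero_mul]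
    · rw [h2 t s hts, mul_zero]

/-- [OURS · L1 W4.6] Characteristic two, no linear terms, no square-free quadratic monomial:
`jetTwoColength f = n + 1`. [folklore] -/
theorem jetTwoColength_of_no_pair [CharP κ 2] {n : ℕ} {f : MvPowerSeries (Fin n) κ}
    (h1 : ∀ s, coeff (Finsupp.single s 1) f = 0)
    (h2 : ∀ j l : Fin n, j ≠ l → coeff (Finsupp.single j 1 + Finsupp.single l 1) f = 0) :
    jetTwoColength f = n + 1 :=
  jetTwoColength_of_pderiv_mem_sq (pderiv_mem_maximalIdeal_sq h1 h2)

/-- [OURS · L1 W4.6] In ONE variable and characteristic two, a series without linear term has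
`jetTwoColength = 2` (embedding dimension one): `g'` has no constant and no linear term. [folklore] -/
theorem jetTwoColength_one [CharP κ 2] {g : MvPowerSeries (Fin 1) κ}
    (h1 : coeff (Finsupp.single 0 1) g = 0) : jetTwoColength g = 2 :=
  jetTwoColength_of_no_pair (fun s => by rw [Subsingleton.elim s 0]; exact h1)
    (fun j l hjl => absurd (Subsingleton.elim j l) hjl)

/-! ## The residual descent: splitting off every hyperbolic pair (no blow-up involved) -/

/-- [OURS · L1 W4.6] **Residual descent** (characteristic two, every `n`): a series `f ∈ κ⟦X₁,…,Xₙ⟧`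
of order `≥ 2` has a RESIDUAL `g ∈ κ⟦X₁,…,X_m⟧` — `m ≤ n`, `m ≡ n (mod 2)`, `ord g ≥ 2`, `g` WITHOUT
square-free quadratic monomial — with `κ`-isomorphic Milnor algebra `κ⟦X⟧/(∂f) ≃ κ⟦X⟧/(∂g)`; and
`m ≤ n - 2` as soon as `f` has a square-free quadratic monomial. Iterated Greuel–Pfister splitting of
hyperbolic pairs (`pair_reduction`, `descent`). [cite: GreuelPfister2026, Thm 3.5 and Cor 3.7] -/
theorem exists_residual [CharP κ 2] : ∀ (n : ℕ) (f : MvPowerSeries (Fin n) κ), 2 ≤ f.order →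
    ∃ (m : ℕ) (g : MvPowerSeries (Fin m) κ), m ≤ n ∧ m % 2 = n % 2 ∧ 2 ≤ g.order ∧
      (∀ j l : Fin m, j ≠ l → coeff (Finsupp.single j 1 + Finsupp.single l 1) g = 0) ∧
      Nonempty ((MvPowerSeries (Fin n) κ ⧸
          Ideal.span (Set.range fun s => MvPowerSeries.pderiv s f)) ≃ₐ[κ]
        (MvPowerSeries (Fin m) κ ⧸ Ideal.span (Set.range fun t => MvPowerSeries.pderiv t g))) ∧
      ((∃ j l : Fin n, j ≠ l ∧ coeff (Finsupp.single j 1 + Finsupp.single l 1) f ≠ 0) →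
        m + 2 ≤ n) := by
  intro n
  induction n using Nat.strong_induction_on with
  | _ n ih =>
  intro f hf
  by_cases hpair : ∃ j l : Fin n, j ≠ l ∧ coeff (Finsupp.single j 1 + Finsupp.single l 1) f ≠ 0
  · obtain ⟨j, l, hjl, hq⟩ := hpair
    have hf' := (FormalCoordChange.two_le_order_iff _).mp hf
    obtain ⟨F, -, -, hJ, hdj, hdl, hXj, hXl⟩ := pair_reduction hjl hq (hf'.2 j) (hf'.2 l)
    obtain ⟨e, he⟩ := exists_emb_compl_pair hjl
    obtain ⟨ε⟩ := descent e he F hJ hdj hdl hXj hXl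
    have hlt : n - 2 < n := by
      have := Fin.pos j
      omega
    have h2n : 2 ≤ n := by
      have hj := j.isLt
      have hl := l.isLt
      by_contra hn
      have : (j : ℕ) = l := by omega
      exact hjl (Fin.ext this)
    have hg₁ : 2 ≤ (killCompl e (F.symm f)).order :=
      two_le_order_killCompl e (le_order_algEquiv F.symm (N := 2) hf)
    obtain ⟨m, g, hmn, hpar, hg, hnp, ⟨ε'⟩, -⟩ := ih (n - 2) hlt (killCompl e (F.symm f)) hg₁
    refine ⟨m, g, by omega, by omega, hg, hnp, ⟨ε.trans ε'⟩, fun _ => by omega⟩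
  · push Not at hpair
    exact ⟨n, f, le_rfl, rfl, hf, hpair, ⟨AlgEquiv.refl⟩,
      fun ⟨j, l, hjl, hq⟩ => absurd (hpair j l hjl) hq⟩

/-- [OURS · L1 W4.6] **The embedding dimension is the number of residual variables**: with a residual
`g` in `m` variables as in `exists_residual`, `jetTwoColength f = m + 1`. [folklore] -/
theorem jetTwoColength_eq_of_residual [CharP κ 2] {n m : ℕ} {f : MvPowerSeries (Fin n) κ}
    {g : MvPowerSeries (Fin m) κ} (hg : 2 ≤ g.order)
    (hnp : ∀ j l : Fin m, j ≠ l → coeff (Finsupp.single j 1 + Finsupp.single l 1) g = 0)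
    (ε : (MvPowerSeries (Fin n) κ ⧸ Ideal.span (Set.range fun s => MvPowerSeries.pderiv s f)) ≃ₐ[κ]
      (MvPowerSeries (Fin m) κ ⧸ Ideal.span (Set.range fun t => MvPowerSeries.pderiv t g))) :
    jetTwoColength f = m + 1 := by
  rw [jetTwoColength_eq_of_equiv ε]
  exact jetTwoColength_of_no_pair ((FormalCoordChange.two_le_order_iff _).mp hg).2 hnp

/-! ## Formal corollaries: range, parity, the pair criterion, the two small values -/

/-- [OURS · L1 W4.6] **Range and PARITY** (characteristic two): for `f` of order `≥ 2` in `n`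
variables, `1 ≤ jetTwoColength f ≤ n + 1` and `jetTwoColength f ≡ n + 1 (mod 2)` — the embedding
dimension `e = jetTwoColength f - 1` satisfies `0 ≤ e ≤ n`, `e ≡ n (mod 2)` (the rank of the polar
form is EVEN: it is alternating). [folklore] -/
theorem jetTwoColength_range [CharP κ 2] {n : ℕ} {f : MvPowerSeries (Fin n) κ} (hf : 2 ≤ f.order) :
    1 ≤ jetTwoColength f ∧ jetTwoColength f ≤ n + 1 ∧ jetTwoColength f % 2 = (n + 1) % 2 := by
  obtain ⟨m, g, hmn, hpar, hg, hnp, ⟨ε⟩, -⟩ := exists_residual n f hf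
  rw [jetTwoColength_eq_of_residual hg hnp ε]
  omega

/-- [OURS · L1 W4.6] **The pair criterion** (characteristic two): `f` of order `≥ 2` has a square-free
quadratic monomial iff its embedding dimension is `≤ n - 2`, i.e. `jetTwoColength f + 2 ≤ n + 1`;
no such monomial iff `jetTwoColength f = n + 1`. [folklore] -/
theorem exists_pair_iff_jetTwoColength [CharP κ 2] {n : ℕ} {f : MvPowerSeries (Fin n) κ}
    (hf : 2 ≤ f.order) :
    (∃ j l : Fin n, j ≠ l ∧ coeff (Finsupp.single j 1 + Finsupp.single l 1) f ≠ 0) ↔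
      jetTwoColength f + 2 ≤ n + 1 := by
  constructor
  · intro h
    obtain ⟨m, g, hmn, -, hg, hnp, ⟨ε⟩, hlt⟩ := exists_residual n f hf
    rw [jetTwoColength_eq_of_residual hg hnp ε]
    have := hlt h
    omega
  · intro h
    by_contra hn
    push Not at hn
    rw [jetTwoColength_of_no_pair ((FormalCoordChange.two_le_order_iff _).mp hf).2 hn] at h
    omega


end CampaignW46.HypersurfacesCharTwo

end Summit.ResolutionOfSingularities.ResolutionOfSingularities.Theorems

end
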